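import Summits.FinalStateConjecture.FinalStateConjecture.Theorems.EIHFluxBalanceInertialRecessionHolePackage

/-!
# Route EIHFluxBalance — `InertialRecession`, re-charting: certified static orbits of the
# re-charted hole charts (boosted Schwarzschild static direction; future-orientation)

Helper file for the crux `stmt-FinalStateConjecture-10166`
(`Summit.FinalStateConjecture.FinalStateConjecture.Theses.EIHFluxBalance.InertialRecession`),
stub `stub_rechart` (the transfer P2 of line `sublinear-is-free-clean-window-charges`).

The transfer of the exhaustion clause to the tilted hole slabs (files `…RechartHover`,
`…RechartTransfer`) follows, above the uncertifiable layer `{r < r₊ + δ}`, the STATIC ORBITS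
`σ ↦ ψ(y + σu)` of the boosted Schwarzschild model, `u = Λ∞ e₀`. This file supplies the two
inputs of `mem_causalPast_image_truncTimeSlab_of_orbit` for the re-charted hole charts
`ψ = Φ ∘ A` of the `a = 0` hole-chart package:

* elementary facts on the boosted Schwarzschild background `Kb = boostedKerrBackground (boost V) 0 M 0`
  and its static direction `u = (boost V) e₀`: translation invariance of the domain and of the
  radius, unit rate of the rest time, continuity of the rest time, and the model value
  `Kb(y)(u, u) = −1 + 2M/r(y)` (`kb_boosted_static_*`, `bilin_boosted_static`);
* `isFutureDirected_mfderiv_comp_of_deviation` — for a re-charted chart `ψ = Φ ∘ A` on any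
  reference background: if `Kb(y)(u,u) ≤ −m`, the `C⁰` deviation of `ψ^*g` from `Kb` at `y` is
  `≤ c` with `c‖u‖² < m` (for the hole charts: `m = δ/(2M + δ)` on `{r ≥ 2M + δ}`), then `dψ(y)u`
  is `g`-timelike, and it is FUTURE-directed as soon as the lab chart `Φ` is future-oriented at the
  lab point `A y` (hypothesis (Ofut): `Φ_* w` is future-directed for every `Φ^*g`-timelike `w`
  with `w⁰ > 0`) and `A` raises lab time along `u` (`(DA·u)⁰ > 0`), by the chain rule
  `dψ(y)u = dΦ(A y)(DA(y)u)` (`mfderiv_comp_smooth_apply`).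

[O'Neill 1983, Ch. 5, p. 145; Kerr–Schild 1965; folklore]
-/

noncomputable section

set_option linter.dupNamespace false

open Set Filter Topology Function TopologicalSpace Literature.Geometry.Lorentzian
open scoped Manifold ContDiff

namespace Summit.FinalStateConjecture.FinalStateConjecture.Theorems

/-! ### The boosted Schwarzschild background and its static direction -/

section Boosted

variable {V : E3} (hV : ‖V‖ < 1) (M : ℝ)

/-- Rest-frame coordinates of a point translated along the static direction:
`Λ⁻¹(x + σ Λe₀) = Λ⁻¹x + σ e₀`. [folklore] -/
theorem poincareInv_boost_add_smul (x : E4) (σ : ℝ) :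
    poincareInv (Lorentz.boost V hV) 0
        (x + σ • (Lorentz.boost V hV : E4 ≃L[ℝ] E4) (E4.basisVector 0)) =
      poincareInv (Lorentz.boost V hV) 0 x + σ • E4.basisVector 0 := by
  rw [poincareInv_zero, poincareInv_zero, map_add, map_smul, ContinuousLinearEquiv.symm_apply_apply]

/-- The static direction preserves the rest-frame Kerr–Schild radius (spin `0`):
`r(x + σu) = r(x)`. [folklore] -/
theorem kb_boosted_static_radius (x : E4) (σ : ℝ) :
    (boostedKerrBackground (Lorentz.boost V hV) 0 M 0).radius
        (x + σ • (Lorentz.boost V hV : E4 ≃L[ℝ] E4) (E4.basisVector 0)) =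
      (boostedKerrBackground (Lorentz.boost V hV) 0 M 0).radius x := by
  show Kerr.radius 0 (poincareInv _ 0 _) = Kerr.radius 0 (poincareInv _ 0 _)
  rw [poincareInv_boost_add_smul, Kerr.radius_zero_left, Kerr.radius_zero_left]
  unfold E4.spatialNorm
  congr 1
  ext i
  simp [E4.spatial_apply, Fin.succ_ne_zero]

/-- The static direction raises the rest-frame time at unit rate: `t*(x + σu) = t*(x) + σ`.
[folklore] -/
theorem kb_boosted_static_time (x : E4) (σ : ℝ) :
    (boostedKerrBackground (Lorentz.boost V hV) 0 M 0).time
        (x + σ • (Lorentz.boost V hV : E4 ≃L[ℝ] E4) (E4.basisVector 0)) =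
      (boostedKerrBackground (Lorentz.boost V hV) 0 M 0).time x + σ := by
  show (poincareInv _ 0 _) 0 = (poincareInv _ 0 _) 0 + σ
  rw [poincareInv_boost_add_smul]
  simp

/-- The static direction preserves the boosted exterior. [folklore] -/
theorem kb_boosted_static_mem (x : E4)
    (hx : x ∈ (boostedKerrBackground (Lorentz.boost V hV) 0 M 0).domain) (σ : ℝ) :
    x + σ • (Lorentz.boost V hV : E4 ≃L[ℝ] E4) (E4.basisVector 0) ∈
      (boostedKerrBackground (Lorentz.boost V hV) 0 M 0).domain := by
  change x + σ • (Lorentz.boost V hV : E4 ≃L[ℝ] E4) (E4.basisVector 0) ∈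
    boostedKerrExterior (Lorentz.boost V hV) 0 M 0
  change x ∈ boostedKerrExterior (Lorentz.boost V hV) 0 M 0 at hx
  rw [mem_boostedKerrExterior, Kerr.mem_exterior] at hx ⊢
  have h := kb_boosted_static_radius hV M x σ
  change Kerr.radius 0 (poincareInv _ 0 _) = Kerr.radius 0 (poincareInv _ 0 _) at h
  rw [h]
  exact hx

/-- The rest-frame time of the boosted background is continuous. [folklore] -/
theorem continuous_kb_boosted_time :
    Continuous (boostedKerrBackground (Lorentz.boost V hV) 0 M 0).time := by
  show Continuous fun x ↦ (poincareInv (Lorentz.boost V hV) 0 x) 0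
  exact (PiLp.continuous_apply 2 _ 0).comp (continuous_poincareInv _ _)

/-- **The model value along the static direction**: `Kb(x)(u, u) = −1 + 2M/r(x)` for the boosted
Schwarzschild form (`u = Λe₀` is the boosted static Killing field; `ℓ(e₀) = 1`, `H = M/r`).
Kerr–Schild 1965, §2. [folklore] -/
theorem bilin_boosted_static (x : E4)
    (hx : (boostedKerrBackground (Lorentz.boost V hV) 0 M 0).radius x ≠ 0) :
    (boostedKerrBackground (Lorentz.boost V hV) 0 M 0).bilin x
        ((Lorentz.boost V hV : E4 ≃L[ℝ] E4) (E4.basisVector 0))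
        ((Lorentz.boost V hV : E4 ≃L[ℝ] E4) (E4.basisVector 0)) =
      -1 + 2 * M / (boostedKerrBackground (Lorentz.boost V hV) 0 M 0).radius x := by
  change boostedKerrBilin _ 0 M 0 x _ _ = -1 + 2 * M / Kerr.radius 0 (poincareInv _ 0 x)
  rw [boostedKerrBilin_apply, ContinuousLinearEquiv.symm_apply_apply, kerr_bilin_apply_eq,
    Kerr.nullCovector_basisVector_zero, Minkowski.bilin_basisVector_zero]
  have hr : E4.spatialNorm (poincareInv (Lorentz.boost V hV) 0 x) ≠ 0 := by
    rwa [← Kerr.radius_zero_left]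
  rw [scalarH_zero_spin hr, Kerr.radius_zero_left]
  ring

/-- The model value along the static direction is uniformly negative away from the horizon:
`Kb(x)(u, u) ≤ −δ/(2M + δ)` when `r(x) ≥ 2M + δ`, `M, δ > 0`. [folklore] -/
theorem bilin_boosted_static_le (hM : 0 < M) {δ : ℝ} (hδ : 0 < δ) (x : E4)
    (hx : 2 * M + δ ≤ (boostedKerrBackground (Lorentz.boost V hV) 0 M 0).radius x) :
    (boostedKerrBackground (Lorentz.boost V hV) 0 M 0).bilin x
        ((Lorentz.boost V hV : E4 ≃L[ℝ] E4) (E4.basisVector 0))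
        ((Lorentz.boost V hV : E4 ≃L[ℝ] E4) (E4.basisVector 0)) ≤ -(δ / (2 * M + δ)) := by
  set r := (boostedKerrBackground (Lorentz.boost V hV) 0 M 0).radius x with hr
  have hr0 : 0 < r := by linarith
  rw [bilin_boosted_static hV M x hr0.ne']
  rw [show -1 + 2 * M / r = -((r - 2 * M) / r) by field_simp; ring]
  rw [neg_le_neg_iff, div_le_div_iff₀ (by linarith) hr0]
  nlinarith

end Boosted

/-! ### Future-directed push-forwards of a re-charted chart -/

section KO

variable {𝓢 : Spacetime 4} (Kb : ModelBackground) (U : Opens E4)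
  (Φ : U → 𝓢.carrier) (hΦ : ContMDiff 𝓘(ℝ, E4) (𝓡 4) ∞ Φ) {A : E4 → E4} (hA : ContDiff ℝ ∞ A)
  (hAU : ∀ x ∈ Kb.domain, A x ∈ U)

include hΦ hA in
/-- **Certified directions of a re-charted chart.** Let `ψ = Φ ∘ A` be a re-charted chart on the
reference background `Kb` and `u ∈ E4` a direction with model value `Kb(y)(u, u) ≤ −m` at the
model point `y`. Suppose (Ofut) the lab chart is future-oriented at the lab point `A y` (every
`Φ^*g`-timelike `w` with `w⁰ > 0` pushes forward to a future-directed vector), `A` raises lab time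
along `u` (`(DA(y)u)⁰ > 0`), and the `C⁰` deviation of `ψ^*g` from `Kb` at `y` is at most `c` with
`c‖u‖² < m`. Then `dψ(y)u` is future-directed (timelike):
`g(dψu, dψu) = Kb(u,u) + dev(u,u) ≤ −m + c‖u‖² < 0`, and `dψ(y)u = dΦ(A y)(DA(y)u)`
(`mfderiv_comp_smooth_apply`). For the re-charted hole charts: `Kb` = boosted Schwarzschild,
`u = Λ∞e₀`, `m = δ/(2M + δ)` on `{r ≥ 2M + δ}` (`bilin_boosted_static_le`). [folklore] -/
theorem isFutureDirected_mfderiv_comp_of_deviation (Q : U → Prop)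
    (hOfut : ∀ x : U, Q x → ∀ w : E4, 0 < w 0 →
      𝓢.metric.val (Φ x) (mfderiv 𝓘(ℝ, E4) (𝓡 4) Φ x w) (mfderiv 𝓘(ℝ, E4) (𝓡 4) Φ x w) < 0 →
        𝓢.timeOrientation.IsFutureDirected (mfderiv 𝓘(ℝ, E4) (𝓡 4) Φ x w))
    (y : Kb.domain) (u : E4) (hQ : Q ⟨A y.1, hAU y.1 y.2⟩) (hA0 : 0 < (fderiv ℝ A y.1 u) 0)
    {m c : ℝ} (hbil : Kb.bilin y.1 u u ≤ -m) (hc : c * ‖u‖ ^ 2 < m)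
    (hdev : ‖𝓢.deviation Kb (fun y : Kb.domain ↦ Φ ⟨A y.1, hAU y.1 y.2⟩) y‖ ≤ c) :
    𝓢.timeOrientation.IsFutureDirected (mfderiv 𝓘(ℝ, E4) (𝓡 4)
      (fun y : Kb.domain ↦ Φ ⟨A y.1, hAU y.1 y.2⟩) y u) := by
  set ψ : Kb.domain → 𝓢.carrier := fun y ↦ Φ ⟨A y.1, hAU y.1 y.2⟩ with hψ
  -- the metric value along `dψ u`
  have hval : 𝓢.metric.val (ψ y) (mfderiv 𝓘(ℝ, E4) (𝓡 4) ψ y u) (mfderiv 𝓘(ℝ, E4) (𝓡 4) ψ y u) =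
      Kb.bilin y.1 u u + 𝓢.deviation Kb ψ y u u := by
    rw [Spacetime.deviation_apply]; ring
  have hdevuu : 𝓢.deviation Kb ψ y u u ≤ c * ‖u‖ ^ 2 := by
    have h1 : |𝓢.deviation Kb ψ y u u| ≤ ‖𝓢.deviation Kb ψ y u u‖ :=
      le_of_eq (Real.norm_eq_abs _).symm
    have h2 : ‖𝓢.deviation Kb ψ y u u‖ ≤ ‖𝓢.deviation Kb ψ y‖ * ‖u‖ * ‖u‖ :=
      ((𝓢.deviation Kb ψ y u).le_opNorm u).trans
        (mul_le_mul_of_nonneg_right ((𝓢.deviation Kb ψ y).le_opNorm u) (norm_nonneg _))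
    have h3 : ‖𝓢.deviation Kb ψ y‖ * ‖u‖ * ‖u‖ ≤ c * ‖u‖ ^ 2 := by
      rw [pow_two, ← mul_assoc]
      exact mul_le_mul_of_nonneg_right (mul_le_mul_of_nonneg_right hdev (norm_nonneg _))
        (norm_nonneg _)
    linarith [(abs_le.mp (h1.trans (h2.trans h3))).2]
  have hneg : 𝓢.metric.val (ψ y) (mfderiv 𝓘(ℝ, E4) (𝓡 4) ψ y u)
      (mfderiv 𝓘(ℝ, E4) (𝓡 4) ψ y u) < 0 := by
    rw [hval]; linarith
  -- chain rule and (Ofut)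
  have hchain : mfderiv 𝓘(ℝ, E4) (𝓡 4) ψ y u =
      mfderiv 𝓘(ℝ, E4) (𝓡 4) Φ ⟨A y.1, hAU y.1 y.2⟩ (fderiv ℝ A y.1 u) :=
    mfderiv_comp_smooth_apply hA hAU (Ψ := ψ) (fun _ ↦ rfl) hΦ y u
  rw [hchain]
  refine hOfut ⟨A y.1, hAU y.1 y.2⟩ hQ (fderiv ℝ A y.1 u) hA0 ?_
  rw [← hchain]
  exact hneg

/-- Registered one-line form (stub `isFutureDirected_rechart_of_deviation` of the crux item) of
`isFutureDirected_mfderiv_comp_of_deviation`. [folklore] -/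
theorem isFutureDirected_rechart_of_deviation : open Literature.Geometry.Lorentzian Topology in ∀ {𝓢 : Spacetime 4} (Kb : ModelBackground) (U : TopologicalSpace.Opens E4) (Φ : U → 𝓢.carrier), ContMDiff 𝓘(ℝ, E4) (𝓡 4) ((⊤ : ℕ∞) : WithTop ℕ∞) Φ → ∀ {A : E4 → E4}, ContDiff ℝ ((⊤ : ℕ∞) : WithTop ℕ∞) A → ∀ (hAU : ∀ x ∈ Kb.domain, A x ∈ U) (Q : U → Prop), (∀ x : U, Q x → ∀ w : E4, 0 < w 0 → 𝓢.metric.val (Φ x) (mfderiv 𝓘(ℝ, E4) (𝓡 4) Φ x w) (mfderiv 𝓘(ℝ, E4) (𝓡 4) Φ x w) < 0 → 𝓢.timeOrientation.IsFutureDirected (mfderiv 𝓘(ℝ, E4) (𝓡 4) Φ x w)) → ∀ (y : Kb.domain) (u : E4), Q ⟨A y.1, hAU y.1 y.2⟩ → 0 < (fderiv ℝ A y.1 u) 0 → ∀ {m c : ℝ}, Kb.bilin y.1 u u ≤ -m → c * ‖u‖ ^ 2 < m → ‖𝓢.deviation Kb (fun y : Kb.domain ↦ Φ ⟨A y.1,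 hAU y.1 y.2⟩) y‖ ≤ c → 𝓢.timeOrientation.IsFutureDirected (mfderiv 𝓘(ℝ, E4) (𝓡 4) (fun y : Kb.domain ↦ Φ ⟨A y.1, hAU y.1 y.2⟩) y u) :=
  fun Kb U Φ hΦ _ hA hAU Q hOfut y u hQ hA0 _ _ hbil hc hdev ↦
    isFutureDirected_mfderiv_comp_of_deviation Kb U Φ hΦ hA hAU Q hOfut y u hQ hA0 hbil hc hdev

end KO

end Summit.FinalStateConjecture.FinalStateConjecture.Theorems

end
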